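import Summits.BirchSwinnertonDyer.BirchSwinnertonDyer.Theorems.ClassRecordThreeEulerHalvesAtThreeCartanCoverAssembly
import Mathlib.GroupTheory.Transfer
import Mathlib.LinearAlgebra.Matrix.GeneralLinearGroup.Card
import HarnessLib

/-!
# (OBS′) First bricks toward the Galois leaf OBS — crux idea `inert-hecke-elliptic-torsion`, crux `CartanOnePlaceDegreeLawAtThree` (NUM, stmt-BirchSwinnertonDyer-24801), line `charext`
Typed and proved by the crux ideator `cruxidea-stmt-BirchSwinnertonDyer-24801-1` g0 in `Cruxes/CartanOnePlaceDegreeLawAtThree/Lines/charext.lean` v8.1 (sha16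
946cc3c87a19c590, section `InertHecke`); LANDED verbatim (namespace under `Theorems`) by the crux LEAD (bsd-stepL tam3-p1 g27) so that the OBS prover imports them BY NAME.
Elementary bricks of the refined print chain for OBS `CartanCover.Charext.NoModThreePeriodCharacterExtension` (card `Ideas/inert-hecke-elliptic-torsion.md`): in `𝔽_ℓ`,
`ℓ ≡ 2 (3)`, an element of order `3` of `GL₂` has no eigenvector (`no_eigenvector_of_cube_eq_one`), so a Hecke sum over `3`-cycles of a `3`-torsion additive function
vanishes (`hecke_sum_eq_zero_of_three_cycles`); a matrix of determinant `−1` and non-zero trace exists (`exists_det_neg_one_trace_ne_zero`); every `SL₂(K)`-matrix is a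
product of four unipotents (`exists_unip_factorization`), so an additive `3`-torsion function on a group mapping ONTO `SL₂(𝔽_q)`, `q ≠ 3`, that vanishes on the kernel
vanishes (`additive_trivial_of_trivial_on_ker`), whence (RES-INJ) `modThree_trivial_of_trivial_on_principalLevel` (restriction `H¹(ι(O₀'¹), Λ∕3Λ) → H¹(Γ̄(q), Λ∕3Λ)` is
injective, modulo strong approximation at `q` taken as a hypothesis). Nothing here is about a curve; BSD is proved for no curve. [cite: DiamondTaylor1994, Thm. 1 and §1]
-/

set_option linter.dupNamespace false
set_option autoImplicit false

noncomputable section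

open scoped Classical MatrixGroups

namespace Summit.BirchSwinnertonDyer.BirchSwinnertonDyer.Theorems.CartanCover.Charext

open Summit.BirchSwinnertonDyer.BirchSwinnertonDyer.Theorems
open Literature.NumberTheory.Automorphic

namespace InertHecke

/-- In `𝔽_ℓ` with `ℓ ≡ 2 (mod 3)` the only cube root of unity is `1`. [folklore] -/
theorem eq_one_of_pow_three_eq_one {ℓ : ℕ} [Fact ℓ.Prime] (hℓ : ℓ % 3 = 2) {c : ZMod ℓ} (hc : c ^ 3 = 1) : c = 1 := by
  have hdecomp : ℓ = 3 * (ℓ / 3) + 2 := by omega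
  have hF : c ^ (3 * (ℓ / 3) + 2) = c := by rw [← hdecomp]; exact ZMod.pow_card c
  rw [pow_add, pow_mul, hc, one_pow, one_mul] at hF
  -- c² = c, c ≠ 0
  have hc0 : c ≠ 0 := by rintro rfl; norm_num at hc
  have : c * (c - 1) = 0 := by rw [mul_sub, mul_one, ← sq, hF, sub_self]
  rcases mul_eq_zero.mp this with h | h
  · exact absurd h hc0
  · exact sub_eq_zero.mp h

/-- (β₁) An element of order `3` of `GL₂(𝔽_ℓ)`, `ℓ ≡ 2 (mod 3)`, has no eigenvector: no fixed point on `ℙ¹(𝔽_ℓ)`, so the Hecke permutation it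
induces on `Γ∖ΓαΓ ≅ ℙ¹(𝔽_ℓ)` is a product of `3`-cycles. [folklore] -/
theorem no_eigenvector_of_cube_eq_one {ℓ : ℕ} [Fact ℓ.Prime] (hℓ : ℓ % 3 = 2)
    (x : Matrix (Fin 2) (Fin 2) (ZMod ℓ)) (hx3 : x ^ 3 = 1) (hx1 : x ≠ 1) :
    ¬ ∃ (c : ZMod ℓ) (v : Fin 2 → ZMod ℓ), v ≠ 0 ∧ x.mulVec v = c • v := by
  rintro ⟨c, v, hv, hxv⟩
  -- c³ = 1, hence c = 1
  have hx3v : (x ^ 3).mulVec v = (c ^ 3) • v := by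
    rw [pow_succ, pow_two, ← Matrix.mulVec_mulVec, ← Matrix.mulVec_mulVec]
    simp only [hxv, Matrix.mulVec_smul, smul_smul]
    ring_nf
  rw [hx3, Matrix.one_mulVec] at hx3v
  have hc3 : c ^ 3 = 1 := by
    have h : (c ^ 3 - 1) • v = 0 := by rw [sub_smul, one_smul, ← hx3v, sub_self]
    rcases smul_eq_zero.mp h with h | h
    · exact sub_eq_zero.mp h
    · exact absurd h hv
  have hc1 : c = 1 := eq_one_of_pow_three_eq_one hℓ hc3
  subst hc1
  rw [one_smul] at hxv
  -- M := x - 1 has a kernel vector, so det M = 0 and M² = (tr M) M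
  set M : Matrix (Fin 2) (Fin 2) (ZMod ℓ) := x - 1 with hM
  have hMv : M.mulVec v = 0 := by rw [hM, Matrix.sub_mulVec, hxv, Matrix.one_mulVec, sub_self]
  have hdet : M.det = 0 := Matrix.exists_mulVec_eq_zero_iff.mp ⟨v, hv, hMv⟩
  -- Cayley–Hamilton for `2 × 2` matrices (as `Matrix.sq_eq_trace_smul_sub_det_fin_two` of the Deuring files; inlined to keep this closure light)
  have hCH : M * M = M.trace • M - M.det • (1 : Matrix (Fin 2) (Fin 2) (ZMod ℓ)) := by
    ext i j
    fin_cases i <;> fin_cases j <;>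
      simp [Matrix.mul_apply, Fin.sum_univ_two, Matrix.trace, Matrix.det_fin_two] <;> ring
  have hM2 : M * M = M.trace • M := by rw [hCH, hdet, zero_smul, sub_zero]
  have hxM : x = 1 + M := by rw [hM, add_sub_cancel]
  -- x³ = 1 + (t² + 3t + 3) M
  have hcube : x ^ 3 = 1 + (M.trace ^ 2 + 3 * M.trace + 3) • M := by
    rw [hxM, pow_succ, pow_two]
    simp only [add_mul, mul_add, one_mul, mul_one, smul_mul_assoc, hM2, smul_smul]
    module
  have hM0 : M ≠ 0 := by
    intro h; apply hx1; rw [hxM, h, add_zero]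
  have hpoly : M.trace ^ 2 + 3 * M.trace + 3 = 0 := by
    have h : (M.trace ^ 2 + 3 * M.trace + 3) • M = 0 := by
      have h1 : (1 : Matrix (Fin 2) (Fin 2) (ZMod ℓ)) + (M.trace ^ 2 + 3 * M.trace + 3) • M = 1 + 0 := by
        rw [add_zero, ← hcube, hx3]
      exact add_left_cancel h1
    rcases smul_eq_zero.mp h with h | h
    · exact h
    · exact absurd h hM0
  -- s := t + 1 is a non-trivial cube root of unity: contradiction
  set s : ZMod ℓ := M.trace + 1 with hs
  have hs2 : s ^ 2 + s + 1 = 0 := by rw [hs]; linear_combination hpoly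
  have hs3 : s ^ 3 = 1 := by linear_combination (s - 1) * hs2
  have hs1 : s = 1 := eq_one_of_pow_three_eq_one hℓ hs3
  rw [hs1] at hs2
  norm_num at hs2
  -- (3 : ZMod ℓ) = 0 forces ℓ ∣ 3, i.e. ℓ = 3
  have h3 : (ℓ : ℕ) ∣ 3 := by
    have : ((3 : ℕ) : ZMod ℓ) = 0 := by exact_mod_cast hs2
    exact (ZMod.natCast_eq_zero_iff 3 ℓ).mp this
  have hℓ3 : ℓ = 3 := (Nat.prime_dvd_prime_iff_eq (Fact.out) Nat.prime_three).mp h3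
  omega

/-- (β₂, combinatorial core) a function whose values over every `σ`-orbit `{i, σ i, σ² i}` of a fixed-point-free permutation of exponent `3` sum to zero has
total sum zero. [folklore] -/
theorem sum_eq_zero_of_three_cycles {A ι : Type*} [AddCommGroup A] [Fintype ι] [DecidableEq ι]
    (σ : Equiv.Perm ι) (hfix : ∀ i, σ i ≠ i) (hσ3 : σ ^ 3 = 1) (f : ι → A)
    (hcyc : ∀ i, f i + f (σ i) + f (σ (σ i)) = 0) : ∑ i, f i = 0 := by
  classical
  have hσ3i : ∀ i, σ (σ (σ i)) = i := by
    intro i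
    have := congrArg (fun τ : Equiv.Perm ι => τ i) hσ3
    simpa [pow_succ, Equiv.Perm.mul_apply] using this
  suffices H : ∀ n (s : Finset ι), s.card = n → (∀ i ∈ s, σ i ∈ s) → ∑ i ∈ s, f i = 0 by
    exact H _ Finset.univ rfl (fun i _ => Finset.mem_univ _)
  intro n
  induction n using Nat.strong_induction_on with
  | _ n ih =>
    intro s hs hstab
    rcases s.eq_empty_or_nonempty with rfl | ⟨i, hi⟩
    · simp
    have h1 : σ i ∈ s := hstab i hi
    have h2 : σ (σ i) ∈ s := hstab _ h1
    have d01 : i ≠ σ i := fun h => hfix i h.symm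
    have d12 : σ i ≠ σ (σ i) := fun h => hfix (σ i) h.symm
    have d02 : i ≠ σ (σ i) := by
      intro h; apply hfix i
      have := congrArg σ h
      rw [hσ3i] at this; exact this
    set o : Finset ι := {i, σ i, σ (σ i)} with ho
    have hosub : o ⊆ s := by
      intro j hj; simp only [ho, Finset.mem_insert, Finset.mem_singleton] at hj
      rcases hj with rfl | rfl | rfl <;> assumption
    have hosum : ∑ j ∈ o, f j = 0 := by
      rw [ho, Finset.sum_insert (by simp [d01, d02]), Finset.sum_insert (by simp [d12]), Finset.sum_singleton, ← add_assoc]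
      exact hcyc i
    have hstab' : ∀ j ∈ s \ o, σ j ∈ s \ o := by
      intro j hj
      rw [Finset.mem_sdiff] at hj ⊢
      refine ⟨hstab j hj.1, ?_⟩
      intro hσj
      apply hj.2
      simp only [ho, Finset.mem_insert, Finset.mem_singleton] at hσj ⊢
      rcases hσj with h | h | h
      · right; right; have := congrArg (fun k => σ (σ k)) h; simp only [hσ3i] at this; exact this
      · left; exact σ.injective h
      · right; left; exact σ.injective h
    have hcard : (s \ o).card < n := by
      have h1 := Finset.card_sdiff_add_card_eq_card hosub
      have h2 : 0 < o.card := Finset.card_pos.mpr ⟨i, by simp [ho]⟩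
      omega
    have := ih _ hcard (s \ o) rfl hstab'
    rw [← Finset.sum_sdiff hosub, this, hosum, add_zero]

/-- (β₂) THE 3-CYCLE LEMMA: if `x³ = c` with `c` CENTRAL and `χ`-NULL (e.g. `c = 1` for an elliptic element of order `3`, `c = −1` for order `6`, `χ(−1) = 0` in odd
characteristic) and the coset permutation `σ` of `x` is fixed-point-free of exponent `3`, then the Hecke sum `Σ_i χ(α_i x α_{σ i}⁻¹)` of any additive `χ` vanishes — over
each `3`-cycle the three elements multiply to `α_i x³ α_i⁻¹ = c`. [folklore] -/
theorem hecke_sum_eq_zero_of_three_cycles_central {𝔾 A ι : Type*} [Group 𝔾] [AddCommGroup A] [Fintype ι] [DecidableEq ι]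
    (Γ : Subgroup 𝔾) (χ : Γ → A) (hχ : ∀ a b : Γ, χ (a * b) = χ a + χ b)
    (x c : 𝔾) (hx : x ^ 3 = c) (hc : ∀ g : 𝔾, g * c = c * g) (hcΓ : c ∈ Γ) (hχc : χ ⟨c, hcΓ⟩ = 0)
    (α : ι → 𝔾) (σ : Equiv.Perm ι)
    (hmem : ∀ i, α i * x * (α (σ i))⁻¹ ∈ Γ) (hfix : ∀ i, σ i ≠ i) (hσ3 : σ ^ 3 = 1) :
    ∑ i, χ ⟨α i * x * (α (σ i))⁻¹, hmem i⟩ = 0 := by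
  classical
  have hσ3i : ∀ i, σ (σ (σ i)) = i := by
    intro i
    have := congrArg (fun τ : Equiv.Perm ι => τ i) hσ3
    simpa [pow_succ, Equiv.Perm.mul_apply] using this
  refine sum_eq_zero_of_three_cycles σ hfix hσ3 _ (fun i => ?_)
  rw [← hχ, ← hχ]
  have : (⟨α i * x * (α (σ i))⁻¹, hmem i⟩ : Γ) * ⟨α (σ i) * x * (α (σ (σ i)))⁻¹, hmem (σ i)⟩ *
      ⟨α (σ (σ i)) * x * (α (σ (σ (σ i))))⁻¹, hmem (σ (σ i))⟩ = ⟨c, hcΓ⟩ := by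
    apply Subtype.ext
    simp only [Subgroup.coe_mul, hσ3i]
    have hx' : x * x * x = c := by rw [← hx, pow_succ, pow_two]
    calc α i * x * (α (σ i))⁻¹ * (α (σ i) * x * (α (σ (σ i)))⁻¹) * (α (σ (σ i)) * x * (α i)⁻¹)
        = α i * (x * x * x) * (α i)⁻¹ := by group
      _ = c := by rw [hx', hc, mul_assoc, mul_inv_cancel, mul_one]
  rw [this, hχc]

/-- (β₂, order `3`) the case `x³ = 1`. [folklore] -/
theorem hecke_sum_eq_zero_of_three_cycles {𝔾 A ι : Type*} [Group 𝔾] [AddCommGroup A] [Fintype ι] [DecidableEq ι]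
    (Γ : Subgroup 𝔾) (χ : Γ → A) (hχ : ∀ a b : Γ, χ (a * b) = χ a + χ b)
    (x : 𝔾) (hx : x ^ 3 = 1) (α : ι → 𝔾) (σ : Equiv.Perm ι)
    (hmem : ∀ i, α i * x * (α (σ i))⁻¹ ∈ Γ) (hfix : ∀ i, σ i ≠ i) (hσ3 : σ ^ 3 = 1) :
    ∑ i, χ ⟨α i * x * (α (σ i))⁻¹, hmem i⟩ = 0 := by
  have hχ1 : χ 1 = 0 := by
    have h := hχ 1 1; rw [mul_one] at h
    exact add_left_cancel (h.symm.trans (add_zero _).symm)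
  exact hecke_sum_eq_zero_of_three_cycles_central Γ χ hχ x 1 hx (fun g => by rw [mul_one, one_mul]) Γ.one_mem hχ1 α σ hmem hfix hσ3

/-- (ζ) `GL₂(𝔽₃)` has an element of determinant `−1` and non-zero trace (so `Surj V 3` + Chebotarev give a prime `ℓ ≡ 2 (3)` with `3 ∤ a_ℓ(V)`). [folklore] -/
theorem exists_det_neg_one_trace_ne_zero :
    ∃ g : Matrix (Fin 2) (Fin 2) (ZMod 3), g.det = -1 ∧ g.trace ≠ 0 :=
  ⟨!![1, 1; 2, 1], by decide, by decide⟩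

/-! #### (RES-INJ) restriction to `Γ̄(q)` is injective on mod-`3` classes — PROVED modulo (M0) (v9) -/

section Unipotent

variable {K : Type*} [Field K]

/-- the upper unipotent `(1 x; 0 1)` as a unit. -/
def upperUnip (x : K) : GL (Fin 2) K where
  val := !![1, x; 0, 1]
  inv := !![1, -x; 0, 1]
  val_inv := by rw [Matrix.mul_fin_two, Matrix.one_fin_two]; congr 1; simp
  inv_val := by rw [Matrix.mul_fin_two, Matrix.one_fin_two]; congr 1; simp

/-- the lower unipotent `(1 0; x 1)` as a unit. -/
def lowerUnip (x : K) : GL (Fin 2) K where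
  val := !![1, 0; x, 1]
  inv := !![1, 0; -x, 1]
  val_inv := by rw [Matrix.mul_fin_two, Matrix.one_fin_two]; congr 1; simp
  inv_val := by rw [Matrix.mul_fin_two, Matrix.one_fin_two]; congr 1; simp

/-- the matrix of `(1 x; 0 1)`. [folklore] -/
@[simp] theorem coe_upperUnip (x : K) : ((upperUnip x : GL (Fin 2) K) : Matrix (Fin 2) (Fin 2) K) = !![1, x; 0, 1] := rfl
/-- the matrix of `(1 0; x 1)`. [folklore] -/
@[simp] theorem coe_lowerUnip (x : K) : ((lowerUnip x : GL (Fin 2) K) : Matrix (Fin 2) (Fin 2) K) = !![1, 0; x, 1] := rfl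

/-- `U(0) = 1`. [folklore] -/
theorem upperUnip_zero : (upperUnip 0 : GL (Fin 2) K) = 1 := by
  apply Units.ext; rw [coe_upperUnip, Units.val_one, Matrix.one_fin_two]

/-- `L(0) = 1`. [folklore] -/
theorem lowerUnip_zero : (lowerUnip 0 : GL (Fin 2) K) = 1 := by
  apply Units.ext; rw [coe_lowerUnip, Units.val_one, Matrix.one_fin_two]

/-- `U(x) U(y) = U(x + y)`. [folklore] -/
theorem upperUnip_mul (x y : K) : upperUnip x * upperUnip y = upperUnip (x + y) := by
  apply Units.ext
  rw [Units.val_mul, coe_upperUnip, coe_upperUnip, coe_upperUnip, Matrix.mul_fin_two]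
  congr 1; simp [add_comm]

/-- `L(x) L(y) = L(x + y)`. [folklore] -/
theorem lowerUnip_mul (x y : K) : lowerUnip x * lowerUnip y = lowerUnip (x + y) := by
  apply Units.ext
  rw [Units.val_mul, coe_lowerUnip, coe_lowerUnip, coe_lowerUnip, Matrix.mul_fin_two]
  congr 1; simp [add_comm]

/-- `U(x)^n = U(n x)`. [folklore] -/
theorem upperUnip_pow (x : K) (n : ℕ) : upperUnip x ^ n = upperUnip ((n : K) * x) := by
  induction n with
  | zero => rw [pow_zero, Nat.cast_zero, zero_mul, upperUnip_zero]
  | succ n ih => rw [pow_succ, ih, upperUnip_mul, Nat.cast_succ, add_mul, one_mul]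

/-- `L(x)^n = L(n x)`. [folklore] -/
theorem lowerUnip_pow (x : K) (n : ℕ) : lowerUnip x ^ n = lowerUnip ((n : K) * x) := by
  induction n with
  | zero => rw [pow_zero, Nat.cast_zero, zero_mul, lowerUnip_zero]
  | succ n ih => rw [pow_succ, ih, lowerUnip_mul, Nat.cast_succ, add_mul, one_mul]

/-- `U(x)^p = 1` in characteristic `p`. [folklore] -/
theorem upperUnip_pow_char (p : ℕ) [CharP K p] (x : K) : upperUnip x ^ p = 1 := by
  rw [upperUnip_pow, CharP.cast_eq_zero, zero_mul, upperUnip_zero]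

/-- `L(x)^p = 1` in characteristic `p`. [folklore] -/
theorem lowerUnip_pow_char (p : ℕ) [CharP K p] (x : K) : lowerUnip x ^ p = 1 := by
  rw [lowerUnip_pow, CharP.cast_eq_zero, zero_mul, lowerUnip_zero]

/-- `det U(x) = 1`. [folklore] -/
theorem det_coe_upperUnip (x : K) : ((upperUnip x : GL (Fin 2) K) : Matrix (Fin 2) (Fin 2) K).det = 1 := by
  rw [coe_upperUnip, Matrix.det_fin_two_of]; ring

/-- `det L(x) = 1`. [folklore] -/
theorem det_coe_lowerUnip (x : K) : ((lowerUnip x : GL (Fin 2) K) : Matrix (Fin 2) (Fin 2) K).det = 1 := by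
  rw [coe_lowerUnip, Matrix.det_fin_two_of]; ring

/-- entrywise equality of `2 × 2` matrices given by `!![…]`. [folklore] -/
theorem fin_two_eq {α : Type*} {x₁ x₂ x₃ x₄ y₁ y₂ y₃ y₄ : α} (h₁ : x₁ = y₁) (h₂ : x₂ = y₂) (h₃ : x₃ = y₃) (h₄ : x₄ = y₄) :
    !![x₁, x₂; x₃, x₄] = !![y₁, y₂; y₃, y₄] := by
  subst h₁ h₂ h₃ h₄; rfl

/-- (ρ₁) every `g ∈ SL₂(K)` is a product of four unipotents `L(s) U(x) L(c) U(y)` (`s ∈ {0, −1}`). [folklore] -/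
theorem exists_unip_factorization (g : GL (Fin 2) K) (hg : (g : Matrix (Fin 2) (Fin 2) K).det = 1) :
    ∃ s x c y : K, g = lowerUnip s * upperUnip x * lowerUnip c * upperUnip y := by
  obtain ⟨a, b, c, d, hgm⟩ : ∃ a b c d : K, (g : Matrix (Fin 2) (Fin 2) K) = !![a, b; c, d] :=
    ⟨_, _, _, _, Matrix.eta_fin_two _⟩
  have hdet : a * d - b * c = 1 := by rw [hgm, Matrix.det_fin_two_of] at hg; exact hg
  have key : ∀ s x c' y : K, ((lowerUnip s * upperUnip x * lowerUnip c' * upperUnip y : GL (Fin 2) K) : Matrix (Fin 2) (Fin 2) K)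
      = !![1 + x * c', (1 + x * c') * y + x; s + (s * x + 1) * c', (s + (s * x + 1) * c') * y + (s * x + 1)] := by
    intro s x c' y
    rw [Units.val_mul, Units.val_mul, Units.val_mul, coe_lowerUnip, coe_upperUnip, coe_lowerUnip, coe_upperUnip,
      Matrix.mul_fin_two, Matrix.mul_fin_two, Matrix.mul_fin_two]
    congr 1; ring
  by_cases hc : c = 0
  · have had : a * d = 1 := by rw [hc, mul_zero, sub_zero] at hdet; exact hdet
    have ha : a ≠ 0 := by rintro rfl; rw [zero_mul] at had; exact zero_ne_one had
    refine ⟨-1, (a - 1) / a, a, (b + d - 1) / a, Units.ext ?_⟩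
    rw [key, hgm, hc]
    have e00 : 1 + (a - 1) / a * a = a := by field_simp; ring
    have e01 : (1 + (a - 1) / a * a) * ((b + d - 1) / a) + (a - 1) / a = b := by
      rw [e00]; field_simp; linear_combination had
    have e10 : -1 + (-1 * ((a - 1) / a) + 1) * a = 0 := by field_simp; ring
    have e11 : (-1 + (-1 * ((a - 1) / a) + 1) * a) * ((b + d - 1) / a) + (-1 * ((a - 1) / a) + 1) = d := by
      rw [e10, zero_mul, zero_add]; field_simp; linear_combination (-1 : K) * had
    exact (fin_two_eq e00 e01 e10 e11).symm
  · refine ⟨0, (a - 1) / c, c, (d - 1) / c, Units.ext ?_⟩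
    rw [key, hgm]
    have e00 : 1 + (a - 1) / c * c = a := by field_simp; ring
    have e01 : (1 + (a - 1) / c * c) * ((d - 1) / c) + (a - 1) / c = b := by
      rw [e00]; field_simp; linear_combination hdet
    have e10 : 0 + (0 * ((a - 1) / c) + 1) * c = c := by ring
    have e11 : (0 + (0 * ((a - 1) / c) + 1) * c) * ((d - 1) / c) + (0 * ((a - 1) / c) + 1) = d := by
      rw [e10]; field_simp; ring
    exact (fin_two_eq e00 e01 e10 e11).symm

end Unipotent

/-- (ρ₂) the abstract input `Hom(SL₂(𝔽_q), A[3]) = 0` for `q ≠ 3`, in the form used here: an additive `A`-valued function `χ` with `3χ = 0` on a group `Γ` mapping to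
`GL₂(𝔽_q)` with image exactly `SL₂(𝔽_q)` vanishes as soon as it vanishes on the kernel (unipotents have order `q`, coprime to `3`, and generate). [folklore] -/
theorem additive_trivial_of_trivial_on_ker {Γ A : Type*} [Group Γ] [AddCommGroup A] {q : ℕ} [Fact q.Prime] (hq3 : q ≠ 3)
    (r : Γ →* GL (Fin 2) (ZMod q)) (hdet : ∀ γ, ((r γ : GL (Fin 2) (ZMod q)) : Matrix (Fin 2) (Fin 2) (ZMod q)).det = 1)
    (hsurj : ∀ g : GL (Fin 2) (ZMod q), (g : Matrix (Fin 2) (Fin 2) (ZMod q)).det = 1 → ∃ γ, r γ = g)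
    (χ : Γ → A) (hχ : ∀ a b, χ (a * b) = χ a + χ b) (h3 : ∀ γ, 3 • χ γ = 0) (hker : ∀ γ, r γ = 1 → χ γ = 0) :
    ∀ γ, χ γ = 0 := by
  have hχ1 : χ 1 = 0 := by
    have h := hχ 1 1; rw [mul_one] at h
    exact add_left_cancel (h.symm.trans (add_zero _).symm)
  have hχpow : ∀ (γ : Γ) (n : ℕ), χ (γ ^ n) = n • χ γ := by
    intro γ n
    induction n with
    | zero => rw [pow_zero, hχ1, zero_smul]
    | succ n ih => rw [pow_succ, hχ, ih, succ_nsmul]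
  -- step 1: an element whose image has order dividing `q` is killed
  have step1 : ∀ γ : Γ, r γ ^ q = 1 → χ γ = 0 := by
    intro γ hγ
    have hq0 : (q : ℕ) • χ γ = 0 := by rw [← hχpow, hker _ (by rw [map_pow, hγ])]
    have hmod : q % 3 = 1 ∨ q % 3 = 2 := by
      have h3 : ¬ 3 ∣ q := by
        intro h
        have := (Nat.Prime.eq_one_or_self_of_dvd (Fact.out : q.Prime) 3 h)
        omega
      omega
    have hdecomp : q = 3 * (q / 3) + q % 3 := (Nat.div_add_mod q 3).symm
    have hr : (q % 3) • χ γ = 0 := by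
      have : (3 * (q / 3) + q % 3) • χ γ = 0 := by rw [← hdecomp]; exact hq0
      rwa [add_nsmul, mul_comm, ← smul_smul, h3, smul_zero, zero_add] at this
    rcases hmod with h | h
    · rwa [h, one_nsmul] at hr
    · rw [h] at hr
      have e : 3 • χ γ = 2 • χ γ + χ γ := by rw [show (3 : ℕ) = 2 + 1 from rfl, succ_nsmul]
      have := h3 γ
      rwa [e, hr, zero_add] at this
  -- step 2: factor the image into four unipotents and lift each
  intro γ
  obtain ⟨s, x, c, y, hfac⟩ := exists_unip_factorization (r γ) (hdet γ)
  obtain ⟨γ₁, h₁⟩ := hsurj _ (det_coe_lowerUnip (K := ZMod q) s)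
  obtain ⟨γ₂, h₂⟩ := hsurj _ (det_coe_upperUnip (K := ZMod q) x)
  obtain ⟨γ₃, h₃⟩ := hsurj _ (det_coe_lowerUnip (K := ZMod q) c)
  obtain ⟨γ₄, h₄⟩ := hsurj _ (det_coe_upperUnip (K := ZMod q) y)
  have hk : r ((γ₁ * γ₂ * γ₃ * γ₄)⁻¹ * γ) = 1 := by
    rw [map_mul, map_inv, map_mul, map_mul, map_mul, h₁, h₂, h₃, h₄, ← hfac, inv_mul_cancel]
  have e : γ = (γ₁ * γ₂ * γ₃ * γ₄) * ((γ₁ * γ₂ * γ₃ * γ₄)⁻¹ * γ) := by group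
  rw [e, hχ, hker _ hk, add_zero, hχ, hχ, hχ,
    step1 γ₁ (by rw [h₁]; exact lowerUnip_pow_char q s), step1 γ₂ (by rw [h₂]; exact upperUnip_pow_char q x),
    step1 γ₃ (by rw [h₃]; exact lowerUnip_pow_char q c), step1 γ₄ (by rw [h₄]; exact upperUnip_pow_char q y)]
  simp

/-- **(RES-INJ) PROVED modulo (M0)**: an additive `A`-valued function with `3χ = 0` on `ι(O₀'¹) = coverUnits X q` that vanishes on `Γ̄(q) = principalLevel X q` vanishes
identically — `coverUnits ∕ principalLevel ≅ SL₂(𝔽_q)` by `redHom` ((M0) for the surjectivity, `det_redHom`, `mem_ker_redHom_iff`) and `Hom(SL₂(𝔽_q), A[3]) = 0` for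
`q ≠ 3`. This is the injectivity of `res : H¹(Γ, Λ∕3Λ) → H¹(Γ̄(q), Λ∕3Λ)` in the OBS chain of crux idea `inert-hecke-elliptic-torsion`. [folklore] -/
theorem modThree_trivial_of_trivial_on_principalLevel
    (hM0 : ∀ (D M : ℕ) (C : Finset ℕ) (X : CartanLevelCurveData D M C) (q : ℕ) [Fact q.Prime], q ∈ C →
      ∀ (R : CartanCover.CoverReduction X q) (g : GL (Fin 2) (ZMod q)),
        Matrix.det (g : Matrix (Fin 2) (Fin 2) (ZMod q)) = 1 → ∃ γ : CartanCover.coverUnits X q, R.redHom γ = g)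
    {D M : ℕ} {C : Finset ℕ} (X : CartanLevelCurveData D M C) (q : ℕ) [Fact q.Prime] (hq : q ∈ C) (hq3 : q ≠ 3)
    (R : CartanCover.CoverReduction X q) {A : Type*} [AddCommGroup A]
    (χ : CartanCover.coverUnits X q → A) (hχ : ∀ a b, χ (a * b) = χ a + χ b) (h3 : ∀ γ, 3 • χ γ = 0)
    (hker : ∀ γ : CartanCover.coverUnits X q, (γ : GL (Fin 2) ℝ) ∈ CartanCover.principalLevel X q → χ γ = 0) :
    ∀ γ, χ γ = 0 :=
  additive_trivial_of_trivial_on_ker hq3 R.redHom R.det_redHom (fun g hg => hM0 D M C X q hq R g hg) χ hχ h3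
    (fun γ h1 => hker γ ((R.mem_ker_redHom_iff γ).mp h1))

end InertHecke

end Summit.BirchSwinnertonDyer.BirchSwinnertonDyer.Theorems.CartanCover.Charext

end
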